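import Summits.QuantumFields.BalabanUV.Beta.D1BFx.PackedBlockGlue
import Summits.QuantumFields.BalabanUV.Beta.D1BFx.PackedWardLettersSecond
import Summits.QuantumFields.BalabanUV.Beta.D1BFx.PeriodicArrayWrapColH
import Literature.MathematicalPhysics.QuantumFieldTheory.Balaban1983to89.Beta.SecondOrderResponse

/-!
# `BalabanUV.Beta.D1BFx.PackedLettersAtSites` — road «BF-x» for binder row D1, slot (K), chain step (I) «(A1)-PACKED», brick (B3) PART 3a
# «A1-PACKED-TORUS — THE LETTERS AT COARSE SITES» (`A1-PACKED-SPEC.md` v0.4 §9, PART 3 prep): **PART 1's dictionary letters and PART 2's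
# Ward letters in the exact currency of leaf-03's (B6′) `PackedTowerCombine.hessKer_transfer_road_cov_packed_of_uniform`** — the coarse bonds
# are `ℤ^{d+1}` SITES `(μ, y)`, `(ν, y′)` (torus sources `(siteOf p y, μ)`), the packing weights are the p-FREE `ℋ`-columns `colH G₀ n μ y`
# (PART 1c's coarse-representative invariance `response_siteOf_eq_tsum_colH`), and the first-order Ward letters come from the LIFTED [P1′]
# alone (leaf-03's `ColourLiftAdE3.packedWard₁_adE3` with its source DISCHARGED by PART 2b's `lifted_source_eq_zero`), so that (B3) PART 3
# displays ONE family of table-level Ward identities of the literal ([P1′]∕[P2′] in the `ad e₃` model) and nothing colourless.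

HONEST DEPENDENCY (cell records, verbatim): «continuum YM on T⁴ ⇐ BetaPertH ∧ nine spine estimates (0/9 proved); BetaPertH ⇐ (D1) ∧ (D4) ∧
CAP+tail; G-an2-4 gates asym, D1 and NE2/3/4.»  HONEST FRAMING (cell contract, verbatim): «discharging `BetaPertH` makes Bałaban's UV stability
UNCONDITIONAL — a real constructive-QFT result; it is NOT the continuum limit and NOT the Clay problem.»  THIS MODULE DISCHARGES NOTHING of (K),
of D1 or of the wall: [folklore] composition BY NAME of (B4c) `PeriodicArraySuperpositionTorus.blocksHat_sortK_arr_vertexOfK`, (B4e)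
`PeriodicArrayBiSuperpositionTorus.blocksHat_sortK_arr_packed₂_dir`, PART 1c `PackedBlockGlue.response_siteOf_eq_tsum_colH` ∕ `blocks_of_blocksHat_eq_sum`,
gan24-leaf-05's `PeriodicArrayWrapColH.biLoc_wsum_images_colH`, leaf-03's `ColourLiftAdE3.packedWard₁_adE3`, PART 2b's `lifted_source_eq_zero`.
The STRUCTURAL SOCKETS of the literal's stencils and the LIFTED letters [P1′] are DISPLAYED hypotheses; nothing of Bałaban's is asserted.
No definition, no `def … : Prop`, nothing cited, 0 sorry.  0 root-level binders of row D1 discharged; (K) NOT closed; NOT D1, NOT `BetaPertH`,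
NOT continuum, NOT Clay.

ABSOLUTE RULE (cell charter, verbatim): «No internally-minted statement may enter as a cited fact. Every hypothesis is either kernel-proved in this
package or a verbatim quotation of a PUBLISHED theorem with page reference. The manuscript(s) under audit are NOT citable for their own disputed
steps — they are the thing under adjudication; programme-internal (2001/route/tribunal) claims are never citable.»

CONTENT (torus `n, p`, root `r ∈ box (d+1) n`, `s = n·p`, `G₀ := coDressKBmAt (toSite r) n (KInvStep n 0)`, `M_T := kkt K̂ (fromRows Q̂ τ_T)`,
`ŵ_k := windowMap (n·p) (torusBlockEquiv n p (k.1, k.2.1))`, `κ′_k := k.2.2`; coarse SITES `y y′ : ℤ^{d+1}`).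
* §1 **`packed_first_letter_site`**: `(arr s (vertexOfK G₀ n S μ y))ˆ = Σ_k M_T⁻¹ (inl k) (inr (inl (siteOf p y, μ))) • (arr s (S κ′_k ŵ_k))ˆ`;
  **`ffHat_packed_site`**, **`mfHat_packed_site`** (its ff ∕ mf blocks).
* §2 **`packed_second_letter_site`**: `(arr s 𝒲^{(s)}_{μ y ν y′})ˆ = Σ_{k,l} M_T⁻¹ (inl k) (inr (inl (siteOf p y, μ))) · M_T⁻¹ (inl l) (inr (inl (siteOf p y′, ν)))
  • (Σ'_t arr s (S₂ κ′_k ŵ_k κ′_l (ŵ_l + s·t)))ˆ`, `𝒲^{(s)}_{μ y ν y′} := Σ_{κ′κ″} wsum (colH G₀ n μ y κ′) (u ↦ wsum (u″ ↦ Σ'_m colH G₀ n ν y′ κ″ (u″ + s·m)) (S₂ κ′ u κ″))`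
  under the `LocStencil₂` body and joint period covariance; **`ffHat_packed₂_site`**, **`mfHat_packed₂_site`**.
* §3 **`packed_ward₁_lifted`**, **`packed_ward₁_lifted_field`**: PART 2a's conclusions (`aₛ bₛ aₜ bₜ`) from the LIFTED [P1′] alone (`packedWard₁_adE3` +
  `lifted_source_eq_zero` + the `ward₁` read-out).
* §4 **`vertex2OfK_eq_sliceSum`** (generic `d N`): the bi-vertex `SecondOrderResponse.vertex2OfK K N S₂` IS the slice-summed double superposition `Σ_{κ′κ″} wsum (colH …) (u ↦ wsum (colH …) (S₂ κ′ u κ″))`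
  — the shape gan24-leaf-05's `PeriodicArrayWrapColH` delivers, read back BY NAME (PART 3b's `𝒲M∞`).
Unit `b2b-balaban-beta-d1-p2` (road owner, gen 18), 2026-08-22.
-/

noncomputable section

namespace Summit.QuantumFields.BalabanUV.Beta.D1BFx.PackedLettersAtSites

open Matrix
open scoped BigOperators Kronecker
open Literature.Probability.LatticeModels (TorusSite)
open Literature.MathematicalPhysics.QuantumFieldTheory.Balaban1983to89
open Literature.MathematicalPhysics.QuantumFieldTheory.Balaban1983to89.Beta
open Literature.MathematicalPhysics.QuantumFieldTheory.Balaban1983to89.Beta.Composition (kkt)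
open B12Sec2to5 (l1 l1_nonneg)
open ExpKernelCalculus (MKer BiLoc Decays shiftK Zl Zl_nonneg)
open AffineAveraging (box toSite)
open OneStepResolventKernel (Fib wsum LocStencil summable_wsumTerm bound_mono)
open OneStepKernelFamily (KInvStep colH vertexOfK abs_colH_le)
open BalabanCompositeJets (biLoc_wsum_far)
open SecondOrderResponse (vertex2OfK)
open Summit.QuantumFields.BalabanUV.Beta.AxialDressingRooted (coDressKBmAt decays_coDressKBmAt_KInvStep)
open Summit.QuantumFields.BalabanUV.Beta.D1BFx.FibredPeriodisation (periodiseF)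
open Summit.QuantumFields.BalabanUV.Beta.D1BFx.SortedKernels (blocksHat fTL fBL)
open Summit.QuantumFields.BalabanUV.Beta.D1BFx.SortedReblocking (torusBlockEquiv)
open Summit.QuantumFields.BalabanUV.Beta.D1BFx.SortedPack (sortK)
open Summit.QuantumFields.BalabanUV.Beta.D1BFx.TorusCombKKT (I J CombRows tauT Khat Qhat)
open Summit.QuantumFields.BalabanUV.Beta.D1BFx.TorusGaugeBasis (What0)
open Summit.QuantumFields.BalabanUV.Beta.D1BFx.PeriodicArrays (arr)
open Summit.QuantumFields.BalabanUV.Beta.D1BFx.WardJetsFromNoether (oslot sum_smul_kkt sum_smul_fromRows_zero kkt_mul_fromRows_zero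
  fromRows_add_fromRows fromRows_eq_zero_iff)
open Summit.QuantumFields.BalabanUV.Beta.D1BFx.ColourLiftAdE3 (c₃ e₃ packedWard₁_adE3)
open Summit.QuantumFields.BalabanUV.Beta.D1BFx.PeriodicArraySuperpositionTorus (blocksHat_sortK_arr_vertexOfK)
open Summit.QuantumFields.BalabanUV.Beta.D1BFx.PeriodicArrayBiSuperpositionTorus (blocksHat_sortK_arr_packed₂_dir)
open Summit.QuantumFields.BalabanUV.Beta.D1BFx.PeriodicArrayWrapColH (colH_weight biLoc_wsum_images_colH)
open Summit.QuantumFields.BalabanUV.Beta.D1BFx.PackedDictionaryLetters (locStencil_mono body_mono)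
open Summit.QuantumFields.BalabanUV.Beta.D1BFx.PackedBlockGlue (blocks_of_blocksHat_eq_sum response_siteOf_eq_tsum_colH)
open Summit.QuantumFields.BalabanUV.Beta.D1BFx.PackedWardLettersSecond (lifted_source_eq_zero)

variable {d : ℕ} {n : ℕ} [NeZero n] {r : Fin (d + 1) → ℕ} (hr : r ∈ box (d + 1) n) (p : ℕ) [NeZero p]

/-! ## §1 First order at a coarse SITE: p-free weights, torus source `(siteOf p y, μ)` -/

section First

include hr

/-- [folklore] **THE FIRST-ORDER DICTIONARY LETTER AT A COARSE SITE.**  For a self-localised (`LocStencil S Cs δ`, `δ > 0`), fine-translation-covariant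
stencil family `S`, on every coarse torus and at every `ℤ^{d+1}` coarse bond `(μ, y)`:
`(arr (n·p) (vertexOfK G₀ n S μ y))ˆ = Σ_{k : I d n p} M_T⁻¹ (inl k) (inr (inl (siteOf p y, μ))) • (arr (n·p) (S κ′_k ŵ_k))ˆ` — PART 1's `packed_first_letter` with the
p-FREE site `y` in place of `windowMap p ȳ` ((B4c) + PART 1c `response_siteOf_eq_tsum_colH`; the shape of leaf-03's `𝒱M k := vertexOfK G₀ n S`, CONSTANT in `k`). -/
theorem packed_first_letter_site {S : Fin (d + 1) → (Fin (d + 1) → ℤ) → MKer (d + 1) (Fib d)} {Cs δ : ℝ} (hS : LocStencil S Cs δ) (hCs : 0 ≤ Cs)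
    (hδ : 0 < δ) (hScov : ∀ κ' u v, S κ' (u + v) = shiftK (-v) (S κ' u)) (y : Fin (d + 1) → ℤ) (μ : Fin (d + 1)) :
    blocksHat p (sortK n (arr (n * p) (vertexOfK (coDressKBmAt (toSite r) n (KInvStep (d := d) n 0)) n S μ y)))
      = ∑ k : I d n p,
          (kkt (Khat (d := d) n p) (Matrix.fromRows (Qhat (d := d) n p) (tauT (toSite r) n p)))⁻¹ (Sum.inl k) (Sum.inr (Sum.inl (siteOf (d + 1) p y, μ)))
            • blocksHat p (sortK n (arr (n * p) (S k.2.2 (windowMap (d + 1) (n * p) (torusBlockEquiv n p (k.1, k.2.1)))))) := by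
  obtain ⟨δG, CG, hδG, hCG, hG⟩ := decays_coDressKBmAt_KInvStep (d := d) hr 0
  rw [blocksHat_sortK_arr_vertexOfK hG hCG (locStencil_mono hS hCs (min_le_left δ δG)) (lt_min hδ hδG) (min_le_right δ δG) hScov μ y]
  refine Finset.sum_congr rfl fun k _ => ?_
  rw [response_siteOf_eq_tsum_colH hr p y μ k]

/-- [folklore] **THE ff BLOCK AT A COARSE SITE IS PACKED**: `ff̂(arr (n·p) (vertexOfK G₀ n S μ y)) = Σ_k M_T⁻¹ (inl k) (inr (inl (siteOf p y, μ))) • ff̂(arr (n·p) (S κ′_k ŵ_k))`. -/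
theorem ffHat_packed_site {S : Fin (d + 1) → (Fin (d + 1) → ℤ) → MKer (d + 1) (Fib d)} {Cs δ : ℝ} (hS : LocStencil S Cs δ) (hCs : 0 ≤ Cs)
    (hδ : 0 < δ) (hScov : ∀ κ' u v, S κ' (u + v) = shiftK (-v) (S κ' u)) (y : Fin (d + 1) → ℤ) (μ : Fin (d + 1)) :
    Matrix.of (periodiseF p (fTL (sortK n (arr (n * p) (vertexOfK (coDressKBmAt (toSite r) n (KInvStep (d := d) n 0)) n S μ y)))))
      = ∑ k : I d n p,
          (kkt (Khat (d := d) n p) (Matrix.fromRows (Qhat (d := d) n p) (tauT (toSite r) n p)))⁻¹ (Sum.inl k) (Sum.inr (Sum.inl (siteOf (d + 1) p y, μ)))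
            • Matrix.of (periodiseF p (fTL (sortK n (arr (n * p) (S k.2.2 (windowMap (d + 1) (n * p) (torusBlockEquiv n p (k.1, k.2.1)))))))) :=
  (blocks_of_blocksHat_eq_sum p _ _ _ (packed_first_letter_site hr p hS hCs hδ hScov y μ)).1

/-- [folklore] **THE mf BLOCK AT A COARSE SITE IS PACKED** (the constraint jet). -/
theorem mfHat_packed_site {S : Fin (d + 1) → (Fin (d + 1) → ℤ) → MKer (d + 1) (Fib d)} {Cs δ : ℝ} (hS : LocStencil S Cs δ) (hCs : 0 ≤ Cs)
    (hδ : 0 < δ) (hScov : ∀ κ' u v, S κ' (u + v) = shiftK (-v) (S κ' u)) (y : Fin (d + 1) → ℤ) (μ : Fin (d + 1)) :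
    Matrix.of (periodiseF p (fBL (sortK n (arr (n * p) (vertexOfK (coDressKBmAt (toSite r) n (KInvStep (d := d) n 0)) n S μ y)))))
      = ∑ k : I d n p,
          (kkt (Khat (d := d) n p) (Matrix.fromRows (Qhat (d := d) n p) (tauT (toSite r) n p)))⁻¹ (Sum.inl k) (Sum.inr (Sum.inl (siteOf (d + 1) p y, μ)))
            • Matrix.of (periodiseF p (fBL (sortK n (arr (n * p) (S k.2.2 (windowMap (d + 1) (n * p) (torusBlockEquiv n p (k.1, k.2.1)))))))) :=
  (blocks_of_blocksHat_eq_sum p _ _ _ (packed_first_letter_site hr p hS hCs hδ hScov y μ)).2.2.1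

end First

/-! ## §2 Second order at a pair of coarse SITES -/

section Second

include hr

/-- [folklore] **THE SECOND-ORDER DICTIONARY LETTER AT COARSE SITES** (PART 1's `packed_second_letter` with p-FREE sites `y y′` and weights
`colH G₀ n μ y`, `colH G₀ n ν y′` — the currency of leaf-03's `𝒲M k μ 0 ν z`): for a fine bi-stencil family with the `LocStencil₂` body, jointly
covariant under the period translates,
`(arr s 𝒲^{(s)}_{μ y ν y′})ˆ = Σ_{k l : I d n p} M_T⁻¹ (inl k) (inr (inl (siteOf p y, μ))) · M_T⁻¹ (inl l) (inr (inl (siteOf p y′, ν))) • (Σ'_t arr s (S₂ κ′_k ŵ_k κ′_l (ŵ_l + s·t)))ˆ`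
((B4e) with gan24-leaf-05's `biLoc_wsum_images_colH` as the «WRAP-UNIFORM» socket + `response_siteOf_eq_tsum_colH`). -/
theorem packed_second_letter_site
    {S₂ : Fin (d + 1) → (Fin (d + 1) → ℤ) → Fin (d + 1) → (Fin (d + 1) → ℤ) → MKer (d + 1) (Fib d)} {Ck δ : ℝ}
    (hS₂ : ∀ κ u κ' u', BiLoc (S₂ κ u κ' u') u u (Ck * Real.exp (-δ * l1 (u' - u))) δ) (hCk : 0 ≤ Ck) (hδ : 0 < δ)
    (hS₂cov : ∀ κ' κ'' u u' m, S₂ κ' (imageShift (n * p) u m) κ'' (imageShift (n * p) u' m) = shiftK (-(((n * p : ℕ) : ℤ) • m)) (S₂ κ' u κ'' u'))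
    (y y' : Fin (d + 1) → ℤ) (μ ν : Fin (d + 1)) :
    blocksHat p (sortK n (arr (n * p) (fun x z a b => ∑ κ' : Fin (d + 1), ∑ κ'' : Fin (d + 1),
        wsum (colH (coDressKBmAt (toSite r) n (KInvStep (d := d) n 0)) n μ y κ')
          (fun u => wsum (fun u'' => ∑' m : Fin (d + 1) → ℤ,
            colH (coDressKBmAt (toSite r) n (KInvStep (d := d) n 0)) n ν y' κ'' (imageShift (n * p) u'' m)) (S₂ κ' u κ'')) x z a b)))
      = ∑ k : I d n p, ∑ l : I d n p,
          ((kkt (Khat (d := d) n p) (Matrix.fromRows (Qhat (d := d) n p) (tauT (toSite r) n p)))⁻¹ (Sum.inl k) (Sum.inr (Sum.inl (siteOf (d + 1) p y, μ)))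
            * (kkt (Khat (d := d) n p) (Matrix.fromRows (Qhat (d := d) n p) (tauT (toSite r) n p)))⁻¹ (Sum.inl l) (Sum.inr (Sum.inl (siteOf (d + 1) p y', ν))))
            • blocksHat p (sortK n (fun x z a b => ∑' t : Fin (d + 1) → ℤ,
                arr (n * p) (S₂ k.2.2 (windowMap (d + 1) (n * p) (torusBlockEquiv n p (k.1, k.2.1))) l.2.2
                  (imageShift (n * p) (windowMap (d + 1) (n * p) (torusBlockEquiv n p (l.1, l.2.1))) t)) x z a b)) := by
  obtain ⟨δG, CG, hδG, hCG, hG⟩ := decays_coDressKBmAt_KInvStep (d := d) hr 0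
  have hδ' : 0 < min δ δG := lt_min hδ hδG
  have hw : ∀ κ' u, |colH (coDressKBmAt (toSite r) n (KInvStep (d := d) n 0)) n μ y κ' u| ≤ CG * Real.exp (-(min δ δG) * l1 (u - (n : ℤ) • y)) :=
    fun κ' u => colH_weight hG hCG (min_le_right _ _) μ y κ' u
  have hw' : ∀ κ' u, |colH (coDressKBmAt (toSite r) n (KInvStep (d := d) n 0)) n ν y' κ' u| ≤ CG * Real.exp (-(min δ δG) * l1 (u - (n : ℤ) • y')) :=
    fun κ' u => colH_weight hG hCG (min_le_right _ _) ν y' κ' u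
  -- the «WRAP-UNIFORM» socket of (B4e), per slice, by gan24-leaf-05's `biLoc_wsum_images_colH` at the common rate
  have hWloc : ∀ κ' κ'', BiLoc (wsum (colH (coDressKBmAt (toSite r) n (KInvStep (d := d) n 0)) n μ y κ')
      (fun u => wsum (fun u'' => ∑' m : Fin (d + 1) → ℤ,
        colH (coDressKBmAt (toSite r) n (KInvStep (d := d) n 0)) n ν y' κ'' (imageShift (n * p) u'' m)) (S₂ κ' u κ'')))
      ((n : ℤ) • y) ((n : ℤ) • y)
      (CG * (CG * Ck * Zl (d + 1) (min δ δG / 2) * Zl (d + 1) (min δ δG / 2)) * Zl (d + 1) (min δ δG / 2)) (min δ δG / 2) :=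
    fun κ' κ'' => biLoc_wsum_images_colH hG hCG (body_mono hS₂ hCk (min_le_left _ _)) hδ' (min_le_right _ _) (n * p) μ ν y y' κ' κ''
  have h := blocksHat_sortK_arr_packed₂_dir (n := n) (p := p) (S₂ := S₂)
    (P := fun _ => (n : ℤ) • y) (P' := fun _ => (n : ℤ) • y')
    hw hw' (body_mono hS₂ hCk (min_le_left _ _)) hS₂cov hδ' hCG hCG hCk hWloc (half_pos hδ')
  refine Eq.trans ?_ (h.trans ?_)
  · rfl
  refine Finset.sum_congr rfl fun k _ => Finset.sum_congr rfl fun l _ => ?_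
  rw [response_siteOf_eq_tsum_colH hr p y μ k, response_siteOf_eq_tsum_colH hr p y' ν l]

/-- [folklore] **THE SECOND ff BLOCK AT COARSE SITES IS PACKED** (the even packed second form jet `kₛₜ` as the response-packed sum of the per-pair ff blocks). -/
theorem ffHat_packed₂_site
    {S₂ : Fin (d + 1) → (Fin (d + 1) → ℤ) → Fin (d + 1) → (Fin (d + 1) → ℤ) → MKer (d + 1) (Fib d)} {Ck δ : ℝ}
    (hS₂ : ∀ κ u κ' u', BiLoc (S₂ κ u κ' u') u u (Ck * Real.exp (-δ * l1 (u' - u))) δ) (hCk : 0 ≤ Ck) (hδ : 0 < δ)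
    (hS₂cov : ∀ κ' κ'' u u' m, S₂ κ' (imageShift (n * p) u m) κ'' (imageShift (n * p) u' m) = shiftK (-(((n * p : ℕ) : ℤ) • m)) (S₂ κ' u κ'' u'))
    (y y' : Fin (d + 1) → ℤ) (μ ν : Fin (d + 1)) :
    Matrix.of (periodiseF p (fTL (sortK n (arr (n * p) (fun x z a b => ∑ κ' : Fin (d + 1), ∑ κ'' : Fin (d + 1),
        wsum (colH (coDressKBmAt (toSite r) n (KInvStep (d := d) n 0)) n μ y κ')
          (fun u => wsum (fun u'' => ∑' m : Fin (d + 1) → ℤ,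
            colH (coDressKBmAt (toSite r) n (KInvStep (d := d) n 0)) n ν y' κ'' (imageShift (n * p) u'' m)) (S₂ κ' u κ'')) x z a b)))))
      = ∑ k : I d n p, ∑ l : I d n p,
          ((kkt (Khat (d := d) n p) (Matrix.fromRows (Qhat (d := d) n p) (tauT (toSite r) n p)))⁻¹ (Sum.inl k) (Sum.inr (Sum.inl (siteOf (d + 1) p y, μ)))
            * (kkt (Khat (d := d) n p) (Matrix.fromRows (Qhat (d := d) n p) (tauT (toSite r) n p)))⁻¹ (Sum.inl l) (Sum.inr (Sum.inl (siteOf (d + 1) p y', ν))))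
            • Matrix.of (periodiseF p (fTL (sortK n (fun x z a b => ∑' t : Fin (d + 1) → ℤ,
                arr (n * p) (S₂ k.2.2 (windowMap (d + 1) (n * p) (torusBlockEquiv n p (k.1, k.2.1))) l.2.2
                  (imageShift (n * p) (windowMap (d + 1) (n * p) (torusBlockEquiv n p (l.1, l.2.1))) t)) x z a b)))) := by
  have h := (blocks_of_blocksHat_eq_sum p (fun kl : I d n p × I d n p =>
      (kkt (Khat (d := d) n p) (Matrix.fromRows (Qhat (d := d) n p) (tauT (toSite r) n p)))⁻¹ (Sum.inl kl.1) (Sum.inr (Sum.inl (siteOf (d + 1) p y, μ)))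
        * (kkt (Khat (d := d) n p) (Matrix.fromRows (Qhat (d := d) n p) (tauT (toSite r) n p)))⁻¹ (Sum.inl kl.2) (Sum.inr (Sum.inl (siteOf (d + 1) p y', ν))))
    _ (fun kl : I d n p × I d n p => sortK n (fun x z a b => ∑' t : Fin (d + 1) → ℤ,
      arr (n * p) (S₂ kl.1.2.2 (windowMap (d + 1) (n * p) (torusBlockEquiv n p (kl.1.1, kl.1.2.1))) kl.2.2.2
        (imageShift (n * p) (windowMap (d + 1) (n * p) (torusBlockEquiv n p (kl.2.1, kl.2.2.1))) t)) x z a b))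
    (by rw [packed_second_letter_site hr p hS₂ hCk hδ hS₂cov y y' μ ν, ← Fintype.sum_prod_type'])).1
  rw [h, ← Fintype.sum_prod_type']

/-- [folklore] **THE SECOND mf BLOCK AT COARSE SITES IS PACKED** (the even packed second constraint jet `qₛₜ`). -/
theorem mfHat_packed₂_site
    {S₂ : Fin (d + 1) → (Fin (d + 1) → ℤ) → Fin (d + 1) → (Fin (d + 1) → ℤ) → MKer (d + 1) (Fib d)} {Ck δ : ℝ}
    (hS₂ : ∀ κ u κ' u', BiLoc (S₂ κ u κ' u') u u (Ck * Real.exp (-δ * l1 (u' - u))) δ) (hCk : 0 ≤ Ck) (hδ : 0 < δ)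
    (hS₂cov : ∀ κ' κ'' u u' m, S₂ κ' (imageShift (n * p) u m) κ'' (imageShift (n * p) u' m) = shiftK (-(((n * p : ℕ) : ℤ) • m)) (S₂ κ' u κ'' u'))
    (y y' : Fin (d + 1) → ℤ) (μ ν : Fin (d + 1)) :
    Matrix.of (periodiseF p (fBL (sortK n (arr (n * p) (fun x z a b => ∑ κ' : Fin (d + 1), ∑ κ'' : Fin (d + 1),
        wsum (colH (coDressKBmAt (toSite r) n (KInvStep (d := d) n 0)) n μ y κ')
          (fun u => wsum (fun u'' => ∑' m : Fin (d + 1) → ℤ,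
            colH (coDressKBmAt (toSite r) n (KInvStep (d := d) n 0)) n ν y' κ'' (imageShift (n * p) u'' m)) (S₂ κ' u κ'')) x z a b)))))
      = ∑ k : I d n p, ∑ l : I d n p,
          ((kkt (Khat (d := d) n p) (Matrix.fromRows (Qhat (d := d) n p) (tauT (toSite r) n p)))⁻¹ (Sum.inl k) (Sum.inr (Sum.inl (siteOf (d + 1) p y, μ)))
            * (kkt (Khat (d := d) n p) (Matrix.fromRows (Qhat (d := d) n p) (tauT (toSite r) n p)))⁻¹ (Sum.inl l) (Sum.inr (Sum.inl (siteOf (d + 1) p y', ν))))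
            • Matrix.of (periodiseF p (fBL (sortK n (fun x z a b => ∑' t : Fin (d + 1) → ℤ,
                arr (n * p) (S₂ k.2.2 (windowMap (d + 1) (n * p) (torusBlockEquiv n p (k.1, k.2.1))) l.2.2
                  (imageShift (n * p) (windowMap (d + 1) (n * p) (torusBlockEquiv n p (l.1, l.2.1))) t)) x z a b)))) := by
  have h := (blocks_of_blocksHat_eq_sum p (fun kl : I d n p × I d n p =>
      (kkt (Khat (d := d) n p) (Matrix.fromRows (Qhat (d := d) n p) (tauT (toSite r) n p)))⁻¹ (Sum.inl kl.1) (Sum.inr (Sum.inl (siteOf (d + 1) p y, μ)))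
        * (kkt (Khat (d := d) n p) (Matrix.fromRows (Qhat (d := d) n p) (tauT (toSite r) n p)))⁻¹ (Sum.inl kl.2) (Sum.inr (Sum.inl (siteOf (d + 1) p y', ν))))
    _ (fun kl : I d n p × I d n p => sortK n (fun x z a b => ∑' t : Fin (d + 1) → ℤ,
      arr (n * p) (S₂ kl.1.2.2 (windowMap (d + 1) (n * p) (torusBlockEquiv n p (kl.1.1, kl.1.2.1))) kl.2.2.2
        (imageShift (n * p) (windowMap (d + 1) (n * p) (torusBlockEquiv n p (kl.2.1, kl.2.2.1))) t)) x z a b))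
    (by rw [packed_second_letter_site hr p hS₂ hCk hδ hS₂cov y y' μ ν, ← Fintype.sum_prod_type'])).2.2.1
  rw [h, ← Fintype.sum_prod_type']

end Second

/-! ## §3 The first-order Ward letters from the LIFTED [P1′] alone -/

section WardLifted

include hr

/-- [folklore] **THE PACKED FIRST-ORDER WARD LETTERS FROM THE LIFTED JETS.**  For per-bond data `K₁ Q₁ x₁` on `I ⊕ J`, ANY colour family `C` with
`C 2 = c₃` (the `ad e₃` model, ρ-g16-1′), the DISPLAYED LIFTED letters [P1′], and ANY non-field source `b` with packed response
`r_b k := M_T⁻¹ (Sum.map id inl k) (inr b)`: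
`(Σ_k r_b k • K₁ k)·Ŵ₀ + K̂·(Σ_k r_b k • x₁ k) = 0 ∧ (Σ_k r_b k • Q₁ k)·Ŵ₀ + Q̂·(Σ_k r_b k • x₁ k) = 0` — PART 2a's `packed_ward₁` with the colourless
[P1] REPLACED by [P1′] (leaf-03's `packedWard₁_adE3`; its lifted source DISCHARGED by PART 2b's `lifted_source_eq_zero`; `ward₁`'s read-out). -/
theorem packed_ward₁_lifted (C : Fin 3 → Matrix (Fin 3) (Fin 3) ℝ) (hC : C 2 = c₃)
    (K₁ : I d n p ⊕ J d p → Matrix (I d n p) (I d n p) ℝ) (Q₁ : I d n p ⊕ J d p → Matrix (J d p) (I d n p) ℝ)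
    (x₁ : I d n p ⊕ J d p → Matrix (I d n p) (CombRows (toSite r) n p) ℝ)
    (hP1 : ∀ q : Fin 3 × (I d n p ⊕ J d p),
      (C q.1 ⊗ₖ kkt (K₁ q.2) (Q₁ q.2)) * ((1 : Matrix (Fin 3) (Fin 3) ℝ) ⊗ₖ Matrix.fromRows (What0 r n p) (0 : Matrix (J d p) (CombRows (toSite r) n p) ℝ))
      + ((1 : Matrix (Fin 3) (Fin 3) ℝ) ⊗ₖ kkt (Khat (d := d) n p) (Qhat (d := d) n p))
          * (C q.1 ⊗ₖ Matrix.fromRows (x₁ q.2) (0 : Matrix (J d p) (CombRows (toSite r) n p) ℝ))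
      + oslot (fun q' : Fin 3 × (I d n p ⊕ J d p) => C q'.1 ⊗ₖ Matrix.fromRows (x₁ q'.2) (0 : Matrix (J d p) (CombRows (toSite r) n p) ℝ))
          (fun i => ((1 : Matrix (Fin 3) (Fin 3) ℝ) ⊗ₖ kkt (Khat (d := d) n p) (Qhat (d := d) n p)) i q) = 0)
    (b : J d p ⊕ CombRows (toSite r) n p) :
    (∑ k, (kkt (Khat (d := d) n p) (Matrix.fromRows (Qhat (d := d) n p) (tauT (toSite r) n p)))⁻¹ (Sum.map id Sum.inl k) (Sum.inr b) • K₁ k) * What0 r n p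
        + Khat (d := d) n p * (∑ k, (kkt (Khat (d := d) n p) (Matrix.fromRows (Qhat (d := d) n p) (tauT (toSite r) n p)))⁻¹ (Sum.map id Sum.inl k) (Sum.inr b) • x₁ k) = 0
      ∧ (∑ k, (kkt (Khat (d := d) n p) (Matrix.fromRows (Qhat (d := d) n p) (tauT (toSite r) n p)))⁻¹ (Sum.map id Sum.inl k) (Sum.inr b) • Q₁ k) * What0 r n p
        + Qhat (d := d) n p * (∑ k, (kkt (Khat (d := d) n p) (Matrix.fromRows (Qhat (d := d) n p) (tauT (toSite r) n p)))⁻¹ (Sum.map id Sum.inl k) (Sum.inr b) • x₁ k) = 0 := by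
  have h := packedWard₁_adE3 C hC (kkt (Khat (d := d) n p) (Qhat (d := d) n p)) (fun q => kkt (K₁ q) (Q₁ q))
    (Matrix.fromRows (What0 r n p) (0 : Matrix (J d p) (CombRows (toSite r) n p) ℝ))
    (fun q => Matrix.fromRows (x₁ q) (0 : Matrix (J d p) (CombRows (toSite r) n p) ℝ)) hP1
    (fun k => (kkt (Khat (d := d) n p) (Matrix.fromRows (Qhat (d := d) n p) (tauT (toSite r) n p)))⁻¹ (Sum.map id Sum.inl k) (Sum.inr b))
    (lifted_source_eq_zero hr p (fun q' => C q'.1) (fun q' => x₁ q'.2) e₃ b)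
  rw [sum_smul_kkt, sum_smul_fromRows_zero, kkt_mul_fromRows_zero, kkt_mul_fromRows_zero, fromRows_add_fromRows, fromRows_eq_zero_iff] at h
  exact h

/-- [folklore] **THE LETTERS `aₛ bₛ` (∕ `aₜ bₜ`) FROM [P1′], FINE-BOND TABLES**: when `K₁ Q₁ x₁` vanish at the coarse-multiplier indices the packed sums run over
the fine bonds `k : I d n p` with the responses `M_T⁻¹ (inl k) (inr b)` — PART 2a's `packed_ward₁_field` conclusion VERBATIM, from the lifted letters. -/
theorem packed_ward₁_lifted_field (C : Fin 3 → Matrix (Fin 3) (Fin 3) ℝ) (hC : C 2 = c₃)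
    (K₁ : I d n p ⊕ J d p → Matrix (I d n p) (I d n p) ℝ) (Q₁ : I d n p ⊕ J d p → Matrix (J d p) (I d n p) ℝ)
    (x₁ : I d n p ⊕ J d p → Matrix (I d n p) (CombRows (toSite r) n p) ℝ)
    (hP1 : ∀ q : Fin 3 × (I d n p ⊕ J d p),
      (C q.1 ⊗ₖ kkt (K₁ q.2) (Q₁ q.2)) * ((1 : Matrix (Fin 3) (Fin 3) ℝ) ⊗ₖ Matrix.fromRows (What0 r n p) (0 : Matrix (J d p) (CombRows (toSite r) n p) ℝ))
      + ((1 : Matrix (Fin 3) (Fin 3) ℝ) ⊗ₖ kkt (Khat (d := d) n p) (Qhat (d := d) n p))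
          * (C q.1 ⊗ₖ Matrix.fromRows (x₁ q.2) (0 : Matrix (J d p) (CombRows (toSite r) n p) ℝ))
      + oslot (fun q' : Fin 3 × (I d n p ⊕ J d p) => C q'.1 ⊗ₖ Matrix.fromRows (x₁ q'.2) (0 : Matrix (J d p) (CombRows (toSite r) n p) ℝ))
          (fun i => ((1 : Matrix (Fin 3) (Fin 3) ℝ) ⊗ₖ kkt (Khat (d := d) n p) (Qhat (d := d) n p)) i q) = 0)
    (hK : ∀ j, K₁ (Sum.inr j) = 0) (hQ : ∀ j, Q₁ (Sum.inr j) = 0) (hx : ∀ j, x₁ (Sum.inr j) = 0) (b : J d p ⊕ CombRows (toSite r) n p) :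
    (∑ k : I d n p, (kkt (Khat (d := d) n p) (Matrix.fromRows (Qhat (d := d) n p) (tauT (toSite r) n p)))⁻¹ (Sum.inl k) (Sum.inr b) • K₁ (Sum.inl k))
          * What0 r n p
        + Khat (d := d) n p * (∑ k : I d n p,
            (kkt (Khat (d := d) n p) (Matrix.fromRows (Qhat (d := d) n p) (tauT (toSite r) n p)))⁻¹ (Sum.inl k) (Sum.inr b) • x₁ (Sum.inl k)) = 0
      ∧ (∑ k : I d n p, (kkt (Khat (d := d) n p) (Matrix.fromRows (Qhat (d := d) n p) (tauT (toSite r) n p)))⁻¹ (Sum.inl k) (Sum.inr b) • Q₁ (Sum.inl k))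
          * What0 r n p
        + Qhat (d := d) n p * (∑ k : I d n p,
            (kkt (Khat (d := d) n p) (Matrix.fromRows (Qhat (d := d) n p) (tauT (toSite r) n p)))⁻¹ (Sum.inl k) (Sum.inr b) • x₁ (Sum.inl k)) = 0 := by
  have h := packed_ward₁_lifted hr p C hC K₁ Q₁ x₁ hP1 b
  simp only [Fintype.sum_sum_type, Sum.map_inl, Sum.map_inr, id, hK, hQ, hx, smul_zero, Finset.sum_const_zero, add_zero] at h
  exact h

end WardLifted

/-! ## §4 The bi-vertex by name (for PART 3b's conclusion) -/

section BiVertex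

variable {N : ℕ}

/-- [folklore] **THE BI-VERTEX IS THE SLICE-SUMMED DOUBLE SUPERPOSITION**: for a decaying packed resolvent `K` (`Decays K C δK`) and a fine bi-stencil family with
the `LocStencil₂` body at a rate `0 < δ ≤ δK`,
`vertex2OfK K N S₂ μ y ν y′ = fun x z a b => Σ_{κ′} Σ_{κ″} wsum (colH K N μ y κ′) (u ↦ wsum (colH K N ν y′ κ″) (S₂ κ′ u κ″)) x z a b`
— the inner finite slice sum commutes with the outer superposition series (`Summable.tsum_finsetSum`; each slice summable by `summable_wsumTerm` over
`biLoc_wsum_far`).  This is the shape gan24-leaf-05's `PeriodicArrayWrapColH` lemmas deliver, read back as `SecondOrderResponse.vertex2OfK` BY NAME. -/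
theorem vertex2OfK_eq_sliceSum {K : MKer (d + 1) (Fib d)} {C δK : ℝ} (hK : Decays K C δK) (hC : 0 ≤ C)
    {S₂ : Fin (d + 1) → (Fin (d + 1) → ℤ) → Fin (d + 1) → (Fin (d + 1) → ℤ) → MKer (d + 1) (Fib d)} {Ck δ : ℝ}
    (hS₂ : ∀ κ u κ' u', BiLoc (S₂ κ u κ' u') u u (Ck * Real.exp (-δ * l1 (u' - u))) δ) (hCk : 0 ≤ Ck) (hδ : 0 < δ) (hδK : δ ≤ δK)
    (μ : Fin (d + 1)) (y : Fin (d + 1) → ℤ) (ν : Fin (d + 1)) (y' : Fin (d + 1) → ℤ) :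
    vertex2OfK K N S₂ μ y ν y'
      = fun x z a b => ∑ κ' : Fin (d + 1), ∑ κ'' : Fin (d + 1), wsum (colH K N μ y κ') (fun u => wsum (colH K N ν y' κ'') (S₂ κ' u κ'')) x z a b := by
  funext x z a b
  simp only [vertex2OfK, vertexOfK, wsum]
  refine Finset.sum_congr rfl fun κ' _ => ?_
  simp_rw [Finset.mul_sum]
  refine Summable.tsum_finsetSum fun κ'' _ => ?_
  -- each slice `u ↦ colH K N μ y κ′ u · (wsum (colH K N ν y′ κ″) (S₂ κ′ u κ″)) x z a b` is summable: a decaying weight against kernels bi-localised at their own index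
  have hw : ∀ u, |colH K N μ y κ' u| ≤ C * Real.exp (-δ * l1 (u - (N : ℤ) • y)) :=
    fun u => bound_mono (abs_colH_le (N := N) hK μ y κ' u) hC le_rfl hδK (l1_nonneg _)
  have hw' : ∀ u, |colH K N ν y' κ'' u| ≤ C * Real.exp (-δ * l1 (u - (N : ℤ) • y')) :=
    fun u => bound_mono (abs_colH_le (N := N) hK ν y' κ'' u) hC le_rfl hδK (l1_nonneg _)
  have hin : ∀ u, BiLoc (wsum (colH K N ν y' κ'') (S₂ κ' u κ'')) u u (C * Ck * Zl (d + 1) (δ / 2)) δ := by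
    intro u x z a b
    have h := biLoc_wsum_far (fun u' => hw' u') (fun u' => hS₂ κ' u κ'' u') hδ hC hCk x z a b
    refine h.trans (mul_le_mul_of_nonneg_right ?_ (Real.exp_nonneg _))
    have hZ := Zl_nonneg (D := d + 1) (half_pos hδ)
    have h1 : Real.exp (-(δ / 2) * l1 (u - (N : ℤ) • y')) ≤ 1 := Real.exp_le_one_iff.2 (by nlinarith [l1_nonneg (u - (N : ℤ) • y')])
    calc C * Ck * Zl (d + 1) (δ / 2) * Real.exp (-(δ / 2) * l1 (u - (N : ℤ) • y'))
        ≤ C * Ck * Zl (d + 1) (δ / 2) * 1 := mul_le_mul_of_nonneg_left h1 (by positivity)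
      _ = C * Ck * Zl (d + 1) (δ / 2) := mul_one _
  exact summable_wsumTerm (K := fun u => wsum (colH K N ν y' κ'') (S₂ κ' u κ'')) hw hin hδ hC x z a b

end BiVertex

end Summit.QuantumFields.BalabanUV.Beta.D1BFx.PackedLettersAtSites

end
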